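import Literature.NumberTheory.EllipticCurves.PadicTwoSupportOfColemanTrace
import Literature.NumberTheory.EllipticCurves.PAdicOneVariableSupportOfColemanTraceRelTwo
import HarnessLib

/-!
# `F = ℚ₂`, relative coefficients: `𝒮_E G = 0` over `𝒪_E` ⟹ the measure of `θ(G ∘ ϑ)` lives on `ℤ₂^×`,
# with the socket — the `θ`-hypotheses discharged for `θ : ℂ_{ℚ₂} ≃ ℂ_[2]`

Topic `NumberTheory/EllipticCurves`; namespace `Literature.NumberTheory.EllipticCurves.PadicTwo`.

The relative-coefficient twin of `PadicTwoSupportOfColemanTrace.lean` (de Shalit 1987, I.3.3 (7) ⟺ (7′),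
I.3.5 (11), over the unramified base as in I.3.8 / III.1.3): Coleman's trace operator `𝒮_E` with coefficients
in `𝒪_E`, `E ⊇ ℚ₂` a finite subextension of `ℚ̄₂` (tree `relTraceTwo`), the generic plugs of
`PAdicOneVariableSupportOfColemanTraceRelTwo.lean`, and `θ := CompletedAlgClosure.equivPadicComplex 2`:

* ★★★ `invAmice₁_μ_eq_zero_of_relTraceTwo_eq_zero` — `𝒮_E G = 0 ⟹` the distribution of `θ(G ∘ ϑ)`
  vanishes on every non-unit class of `ℤ/2^{N+1}`;
* ★★★ `integral_restrictUnits_density_unitInv_pow_succ_of_relTraceTwo_eq_zero` — the socket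
  `∫ x^{k+1} d(restrictUnits (x⁻¹ · D)) = [S^0] D^k` for that series.

Everything is proved; no named facts, no definitions, no instances, no `sorry`.

## References

* [deShalit1987] E. de Shalit, *Iwasawa theory of elliptic curves with complex multiplication* (1987),
  I.3.3 (7)–(8) (p. 17–18), I.3.5 (11) (p. 18), I.3.8.
-/

noncomputable section

open MvPowerSeries Filter
open scoped PowerSeries.WithPiTopology Topology

namespace Literature.NumberTheory.EllipticCurves

namespace PadicTwo

open ValuativeRel IsLocalRing Field
open Literature.NumberTheory.GaloisRepresentations Literature.NumberTheory.GaloisRepresentations.IsNonarchimedeanLocalField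
  Literature.NumberTheory.GaloisRepresentations.LubinTate Literature.NumberTheory.PAdicHodge

attribute [local instance] ltNormUniformSpace ltNormIsUniformAddGroup rk1 nF nE fintypeResidueField

/-- ★★★ **`F = ℚ₂`, relative coefficients: `𝒮_E G = 0 ⟹ D_{θ(G∘ϑ)}` vanishes on every non-unit class**
(`G ∈ 𝒪_E⟦X⟧`, `E ⊇ ℚ₂` finite in `ℚ̄₂`; `f' = π'X + X²`, `π' = 2u`). [cite: deShalit1987, I.3.3 (7)–(7′) (p. 17), I.3.8] -/
theorem invAmice₁_μ_eq_zero_of_relTraceTwo_eq_zero :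
    haveI := Padic.isNonarchimedeanLocalField_holds 2
    ∀ {σ₀ : absoluteGaloisGroup ℚ_[2]} (hσ₀ : IsAbsArithFrob σ₀) (u : 𝒪[ℚ_[2]]ˣ)
      {ε : (maxUnramifiedCompletion ℚ_[2])ˣ}
      (hε : maxUnramifiedCompletion.galAut ℚ_[2] σ₀ (ε : maxUnramifiedCompletion ℚ_[2]) =
        algebraMap 𝒪[ℚ_[2]] (maxUnramifiedCompletion ℚ_[2]) (u : 𝒪[ℚ_[2]]) * (ε : maxUnramifiedCompletion ℚ_[2]))
      (E : IntermediateField ℚ_[2] (AlgebraicClosure ℚ_[2])) [FiniteDimensional ℚ_[2] E]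
      (G : PowerSeries (unitBall E))
      (_hS : relTraceTwo (isUniformizer_unit_mul (Padic.isUniformizer_natCast 2) u) E
        (Padic.residueFieldCard_eq 2) G = 0)
      (N : ℕ) (b : ZMod (2 ^ (N + 1))), ¬IsUnit b →
      (invAmice₁ 2
        ((PowerSeries.subst ((compSeriesC (Padic.isUniformizer_natCast 2) hσ₀ u hε).map
            (algebraMap (UnrCoeff ℚ_[2]) (CBall ℚ_[2]))) (G.map (unitBallToCBall E))).map
          ((CompletedAlgClosure.equivPadicComplex 2).toRingHom.comp (CBall ℚ_[2]).subtype))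
        (norm_coeff_map_le_one _ norm_equivPadicComplex_coe_cBall_le_one _)).μ (N + 1) b = 0 := by
  haveI := Padic.isNonarchimedeanLocalField_holds 2
  intro σ₀ hσ₀ u ε hε E _ G hS N b hb
  exact Literature.NumberTheory.EllipticCurves.invAmice₁_μ_eq_zero_of_relTraceTwo_eq_zero
    (Padic.residueFieldCard_eq 2) (Padic.isUniformizer_natCast 2) hσ₀ u hε _
    continuous_equivPadicComplex_toRingHom norm_equivPadicComplex_coe_cBall_le_one
    exists_pow_two_pow_eq_one_equivPadicComplex_eq E G hS N b hb

/-- ★★★ **`F = ℚ₂`, relative coefficients: THE SOCKET from `𝒮_E G = 0`** — for `H' := θ(G ∘ ϑ) ∈ ℂ_2⟦S⟧`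
and every `k`, `∫ x^{k+1} d(restrictUnits (x⁻¹ · D_{H'})) = [S^0] D^k H'`.
[cite: deShalit1987, I.3.5 (11) (p. 18), I.3.8] -/
theorem integral_restrictUnits_density_unitInv_pow_succ_of_relTraceTwo_eq_zero :
    haveI := Padic.isNonarchimedeanLocalField_holds 2
    ∀ {σ₀ : absoluteGaloisGroup ℚ_[2]} (hσ₀ : IsAbsArithFrob σ₀) (u : 𝒪[ℚ_[2]]ˣ)
      {ε : (maxUnramifiedCompletion ℚ_[2])ˣ}
      (hε : maxUnramifiedCompletion.galAut ℚ_[2] σ₀ (ε : maxUnramifiedCompletion ℚ_[2]) =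
        algebraMap 𝒪[ℚ_[2]] (maxUnramifiedCompletion ℚ_[2]) (u : 𝒪[ℚ_[2]]) * (ε : maxUnramifiedCompletion ℚ_[2]))
      (E : IntermediateField ℚ_[2] (AlgebraicClosure ℚ_[2])) [FiniteDimensional ℚ_[2] E]
      (G : PowerSeries (unitBall E))
      (_hS : relTraceTwo (isUniformizer_unit_mul (Padic.isUniformizer_natCast 2) u) E
        (Padic.residueFieldCard_eq 2) G = 0) (k : ℕ),
      (restrictUnits ((invAmice₁ 2
        ((PowerSeries.subst ((compSeriesC (Padic.isUniformizer_natCast 2) hσ₀ u hε).map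
            (algebraMap (UnrCoeff ℚ_[2]) (CBall ℚ_[2]))) (G.map (unitBallToCBall E))).map
          ((CompletedAlgClosure.equivPadicComplex 2).toRingHom.comp (CBall ℚ_[2]).subtype))
        (norm_coeff_map_le_one _ norm_equivPadicComplex_coe_cBall_le_one _)).density
        (ProfiniteTower.padicInt_isUniform 2) (unitInv ℂ_[2]) uniformContinuous_unitInv norm_unitInv_le)).integral
        (fun x ↦ padicIntCast ℂ_[2] (x ^ (k + 1))) =
      PowerSeries.constantCoeff (mahlerD^[k]
        ((PowerSeries.subst ((compSeriesC (Padic.isUniformizer_natCast 2) hσ₀ u hε).map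
            (algebraMap (UnrCoeff ℚ_[2]) (CBall ℚ_[2]))) (G.map (unitBallToCBall E))).map
          ((CompletedAlgClosure.equivPadicComplex 2).toRingHom.comp (CBall ℚ_[2]).subtype))) := by
  haveI := Padic.isNonarchimedeanLocalField_holds 2
  intro σ₀ hσ₀ u ε hε E _ G hS k
  exact Literature.NumberTheory.EllipticCurves.integral_restrictUnits_density_unitInv_pow_succ_of_relTraceTwo_eq_zero
    (Padic.residueFieldCard_eq 2) (Padic.isUniformizer_natCast 2) hσ₀ u hε _
    continuous_equivPadicComplex_toRingHom norm_equivPadicComplex_coe_cBall_le_one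
    exists_pow_two_pow_eq_one_equivPadicComplex_eq E G hS k

end PadicTwo

end Literature.NumberTheory.EllipticCurves

end
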